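/-
Copyright (c) 2026 the pub-hodgecm-mathlib formalisation cell (harness21).  Prover seat hodgecm-mathlib-K2E4-p13 (g2), Track B «K2-LIT» ∕ h413, ‹S› ROAD J — the (β) assembler's
MEASURE PLUMBING (P1)–(P4) at the central dock (K2E4-p09 (g2) 2026-09-04T00:36:34Z).  2026-09-04.
-/
import Literature.NumberTheory.Rogawski1990.TamagawaFinPartnersMembers          -- ★ the singular guard text; `isHaarMeasure_isInvInvariant_smul_finTamagawaPartner_of_singularGuard`; J0 `lieBallVol_ne_zero_of_guard`
import Literature.NumberTheory.Weil1982.UnitaryFinTopFormOrderIndependence       -- ★ (COH-fin)₀ `map_finTamagawaPartner_conj_eq`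
import Literature.NumberTheory.Weil1982.UnitaryFinTopFormDualLatticeCompact      -- ★ `tracePairing_nondegenerate_of_isSemisimple_of_anisotropic`
import Literature.NumberTheory.Automorphic.OrbitalMeasureQuotientOfPointSingular -- ★ `IsQuotientOf.atPoint_eq_quotientMeasure_of_forall_map_conj_eq`, `orbitalIntegral_atPoint`, `corresponds_local_conj_right`
import Literature.MeasureTheory.Group.InvariantQuotientBlockDescent              -- ★ `quotientMeasure_eq_inv_smul_of_smul_left`
import Literature.MeasureTheory.Group.InvariantQuotientCompactSubgroup           -- ★ `integral_quotientMeasure_eq_inv_smul`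
import Literature.NumberTheory.Rogawski1990.LocalTransferFundamentalLemma        -- ★ `IsLocSmooth`, `IsLocSmooth.continuous`
import HarnessLib

/-!
# ‹S› road J, (β) assembler plumbing: Haar measures at the central dock `θ : H_v ≃ Z(ε)` against the Tamagawa partners `t^ω_v`
# (Rogawski 1990 §1.7 p. 6 «compatible measures», §4.3 (4.3.1) p. 43, §4.9 p. 54; Deitmar–Echterhoff 2014 Thm. 1.5.3, Cor. 1.5.4; Folland 1995 §2.6 (2.52))

Cell `pub/hodgecm-mathlib`, Track B «K2-LIT», crux H413 = `stmt-HodgeConjecture-24833`; ‹S› = `sig_K2E3SingularTransferSigned` (E3-owned), ROAD J: (J♮)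
`sig_K2E3SingularTransferLocalGermValue` ⟸ ★ (α) p856151 `K2E3SingularTransferDressValueAtCentreOfEP` + ‹J3› + THIS plumbing, assembled by K2E4-p09 (g2) in
`Theorems/K2E3SingularTransferLocalGermValueOfRoadJ.lean`.  Asked BY NAME by K2E4-p09 (g2) 2026-09-04T00:36:34Z («PLUMBING I WOULD GLADLY HAND TO K2E4-p13»), taken 00:36:48Z.
THEOREMS ONLY (no `def`, no `instance`, no notation, no `sorry`); lane `--supports stmt-HodgeConjecture-24833 --as helper`.

THE FOUR LETTERS (local frame at ONE finite place `v`: `G′_v = U(H′)(L⁺_v)` with its Borel structures, a two-sided Haar measure `ν_{G,v}`; the SINGULAR GUARD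
`x ↔ (γ₀)_v` for a non-regular rational `γ₀` — ★ `TamagawaFinPartnersMembers`' text verbatim; `t^ω_v(x) = finTamagawaPartner L 3 H′ v x` ★ D1):
* **(P1) `exists_pos_map_dock_eq_smul_finTamagawaPartner`** — for a Haar measure `ν_{H,v}` on `H_v` and a dock `θ : H_v ≃ₜ* Z(x)` at a guard point `x`,
  `θ_* ν_{H,v} = a • t^ω_v(x)` for ONE `a > 0` (`θ_* ν_{H,v}` is Haar, Mathlib `MulEquiv.isHaarMeasure_map`; `t^ω_v(x)` is Haar at guard points, ★ `isHaarMeasure_finTamagawaPartner` over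
  J0 ★ `lieBallVol_ne_zero_of_guard`; Haar uniqueness on the second-countable `Z(x)`, Mathlib `isMulLeftInvariant_eq_smul` ∕ `haarScalarFactor_pos_of_isHaarMeasure`); stated for ANY
  topological group `K` in place of `H_v` (`exists_pos_map_eq_smul_finTamagawaPartner`) and specialised.
* **(P2) `orbitalIntegral_quotientMeasure_eq_inv_smul_of_eq_smul`** (generic `G`) — `μ′ = c • μ` on `Z(x)` (`c ≠ 0`) ⇒ `Φ(x, φ; ν ∕ μ′) = c⁻¹ • Φ(x, φ; ν ∕ μ)`
  (★ `quotientMeasure_eq_inv_smul_of_smul_left`, ★ `orbitalIntegral_smul_measure`); `ℂ`-form `…_eq_inv_mul_…`.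
* **(P3) `classOrbitalIntegral_mk_eq_orbitalIntegral_of_isQuotientOf_finTamagawaPartner`** — for `m = dν_{G,v} ∕ dt^ω_v` on the guard (★ `IsQuotientOf`), at every guard point
  `x` and every Haar inversion-invariant `t` with `t = t^ω_v(x)`: `Φ(⟦x⟧, φ; m) = Φ(x, φ; ν_{G,v} ∕ t)` — the family READ AT THE POINT (★ `IsQuotientOf.atPoint_eq_quotientMeasure_of_forall_map_conj_eq`
  with the guard conjugation-stable ★ `corresponds_local_conj_right` and the partners COHERENT under conjugation on the guard, ★ (COH-fin)₀ `map_finTamagawaPartner_conj_eq` over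
  ★ `tracePairing_nondegenerate_of_isSemisimple_of_anisotropic` ∘ ★ `forall_isSemisimple_toLin'_mat_map_eval_of_guard`; then ★ `orbitalIntegral_atPoint`).
* **(P4) `integral_conj_eq_measureReal_mul_orbitalIntegral`** (generic `G`, compact `Z(x)`) — `∫_G φ(y x y⁻¹) dν = μ(Z(x)) · Φ(x, φ; ν ∕ μ)` (★ `integral_quotientMeasure_eq_inv_smul`);
  cmDatum corollary `…_local` for `φ ∈ C_c^∞`.
Also (P0) `isHaarMeasure_isInvInvariant_finTamagawaPartner_of_guard` (the partner at a guard point is Haar and inversion invariant — the instance binders of (P3)'s `t`).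
HONEST LABEL: HC_CM is proved only modulo the 7 printed citations (2 remaining named inputs: hLiu418 = `stmt-HodgeConjecture-24832`, h413 = `stmt-HodgeConjecture-24833`) until rung 0
closes; this file is unconditional measure bookkeeping and pays no socket by itself.

## References
* [Rogawski1990] J. D. Rogawski, *Automorphic Representations of Unitary Groups in Three Variables*, Ann. of Math. Stud. 123 (1990): §1.7 p. 6 («compatible measures»), §4.3 (4.3.1)
  p. 43, §4.9 p. 54, §8.2 p. 118 (the two sheets at the singular class).
* [DeitmarEchterhoff2014] A. Deitmar, S. Echterhoff, *Principles of Harmonic Analysis*, 2nd ed. (2014), Thm. 1.5.3, Cor. 1.5.4 (invariant quotient measures; compact subgroups).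
* [Folland1995] G. B. Folland, *A Course in Abstract Harmonic Analysis* (1995), §2.6 Thm. 2.49, (2.52).
-/

set_option autoImplicit false
set_option linter.dupNamespace false

noncomputable section

open MeasureTheory MeasureTheory.Measure Set Filter Topology NumberField IsDedekindDomain
open Literature.MeasureTheory.Group Literature.NumberTheory.Automorphic Literature.NumberTheory.Rogawski1990
open Literature.NumberTheory.Weil1982.UnitaryFinTopForm
open Literature.AlgebraicGeometry.ShimuraVarieties (unitaryGroup hermForm)
open scoped Matrix MatrixGroups ENNReal NNReal

namespace Summit.HodgeConjecture.HodgeConjecture.Cruxes.H413.K2E3CentralizerDockHaarPlumbing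

/-! ## §1 Generic group `G`: rescaling the centraliser measure (P2) and the compact-centraliser reading (P4) -/

section Generic

variable {G : Type*} [Group G] [TopologicalSpace G] [IsTopologicalGroup G] [LocallyCompactSpace G] [SecondCountableTopology G] [T2Space G]
  [MeasurableSpace G] [BorelSpace G] (ν : Measure G) [ν.IsHaarMeasure] [ν.IsMulRightInvariant]
  (x : G) [MeasurableSpace (G ⧸ (Subgroup.centralizer ({x} : Set G)))] [BorelSpace (G ⧸ (Subgroup.centralizer ({x} : Set G)))]

/-- **(P2) RESCALING THE CENTRALISER MEASURE RESCALES THE ORBITAL INTEGRAL INVERSELY**: `μ′ = c • μ` on `Z(x)` with `c ≠ 0` ⇒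
`Φ(x, φ; ν ∕ μ′) = c⁻¹ • Φ(x, φ; ν ∕ μ)` (★ `quotientMeasure_eq_inv_smul_of_smul_left`: `ν ∕ (c•μ) = c⁻¹ • (ν ∕ μ)`; ★ `orbitalIntegral_smul_measure`).
[cite: Rogawski1990, §1.7 p. 6; §4.3 (4.3.1) p. 43] [cite: DeitmarEchterhoff2014, Thm. 1.5.3] [cite: Folland1995, §2.6 (2.52)] -/
theorem orbitalIntegral_quotientMeasure_eq_inv_smul_of_eq_smul {E : Type*} [NormedAddCommGroup E] [NormedSpace ℝ E]
    (μ μ' : Measure ↥(Subgroup.centralizer ({x} : Set G))) [μ.IsHaarMeasure] [μ.IsInvInvariant] [μ'.IsHaarMeasure] [μ'.IsInvInvariant]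
    {c : ℝ≥0} (hc : c ≠ 0) (h : μ' = c • μ) (φ : G → E) :
    orbitalIntegral x φ (quotientMeasure (Subgroup.centralizer ({x} : Set G)) μ' (isClosed_coe_centralizer_singleton x) ν) =
      (c : ℝ)⁻¹ • orbitalIntegral x φ (quotientMeasure (Subgroup.centralizer ({x} : Set G)) μ (isClosed_coe_centralizer_singleton x) ν) := by
  rw [quotientMeasure_eq_inv_smul_of_smul_left (Subgroup.centralizer ({x} : Set G)) (isClosed_coe_centralizer_singleton x) μ μ' ν hc h,
    ← Measure.coe_nnreal_smul, orbitalIntegral_smul_measure, ENNReal.coe_toReal, NNReal.coe_inv]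

/-- **(P2), `ℂ`-valued form**: `Φ(x, φ; ν ∕ μ′) = (c⁻¹ : ℂ) · Φ(x, φ; ν ∕ μ)` for `μ′ = c • μ`, `c ≠ 0`. [cite: Rogawski1990, §1.7 p. 6; §4.3 (4.3.1) p. 43] [cite: DeitmarEchterhoff2014, Thm. 1.5.3] -/
theorem orbitalIntegral_quotientMeasure_eq_inv_mul_of_eq_smul
    (μ μ' : Measure ↥(Subgroup.centralizer ({x} : Set G))) [μ.IsHaarMeasure] [μ.IsInvInvariant] [μ'.IsHaarMeasure] [μ'.IsInvInvariant]
    {c : ℝ≥0} (hc : c ≠ 0) (h : μ' = c • μ) (φ : G → ℂ) :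
    orbitalIntegral x φ (quotientMeasure (Subgroup.centralizer ({x} : Set G)) μ' (isClosed_coe_centralizer_singleton x) ν) =
      (((c : ℝ)⁻¹ : ℝ) : ℂ) * orbitalIntegral x φ (quotientMeasure (Subgroup.centralizer ({x} : Set G)) μ (isClosed_coe_centralizer_singleton x) ν) := by
  rw [orbitalIntegral_quotientMeasure_eq_inv_smul_of_eq_smul ν x μ μ' hc h φ, Complex.real_smul]

/-- **(P4) COMPACT CENTRALISER: THE PLAIN CONJUGATION INTEGRAL IS THE CENTRALISER MASS TIMES THE ORBITAL INTEGRAL** — for `Z(x)` compact, `μ` a Haar inversion-invariant measure on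
it and `φ` continuous: `∫_G φ(y x y⁻¹) dν(y) = μ(Z(x)) · Φ(x, φ; ν ∕ μ)` (★ `integral_quotientMeasure_eq_inv_smul`: `ν ∕ μ = μ(Z(x))⁻¹ • π_* ν`; `0 < μ(Z(x)) < ∞`).
[cite: Rogawski1990, §4.9 p. 54; §8.2 p. 118] [cite: DeitmarEchterhoff2014, Cor. 1.5.4] [cite: Folland1995, §2.6 (2.52)] -/
theorem integral_conj_eq_measureReal_mul_orbitalIntegral (μ : Measure ↥(Subgroup.centralizer ({x} : Set G))) [μ.IsHaarMeasure] [μ.IsInvInvariant]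
    [CompactSpace ↥(Subgroup.centralizer ({x} : Set G))] (φ : G → ℂ) (hφ : Continuous φ) :
    ∫ y, φ (y * x * y⁻¹) ∂ν = ((μ.real Set.univ : ℝ) : ℂ) * orbitalIntegral x φ (quotientMeasure (Subgroup.centralizer ({x} : Set G)) μ (isClosed_coe_centralizer_singleton x) ν) := by
  haveI : IsClosed (((Subgroup.centralizer ({x} : Set G)) : Subgroup G) : Set G) := isClosed_coe_centralizer_singleton x
  have hI : orbitalIntegral x φ (quotientMeasure (Subgroup.centralizer ({x} : Set G)) μ (isClosed_coe_centralizer_singleton x) ν) =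
      (μ.real Set.univ)⁻¹ • ∫ g, φ (g * x * g⁻¹) ∂ν := by
    rw [orbitalIntegral_eq_integral_descConj,
      integral_quotientMeasure_eq_inv_smul (Subgroup.centralizer ({x} : Set G)) μ ν _ (continuous_descConj _ _ _ hφ).stronglyMeasurable]
    rfl
  have hne : μ.real Set.univ ≠ 0 := by
    rw [measureReal_def, ENNReal.toReal_ne_zero]
    exact ⟨(isOpen_univ.measure_pos μ univ_nonempty).ne', isCompact_univ.measure_lt_top.ne⟩
  rw [hI, Complex.real_smul, ← mul_assoc, ← Complex.ofReal_mul, mul_inv_cancel₀ hne, Complex.ofReal_one, one_mul]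

end Generic

/-! ## §2 The local unitary group `G′_v = U(H′)(L⁺_v)`: the Tamagawa partners at the singular guard -/

section Local

variable (L : Type) [Field L] [NumberField L] [IsCMField L] (H' : Matrix (Fin 3) (Fin 3) L)
  (hherm : (H'.map (cmConjRingHom L))ᵀ = H') (hanis : ∀ x : Fin 3 → L, hermForm (cmConjRingHom L) H' x x = 0 → x = 0)
  (v : HeightOneSpectrum (𝓞 ↥(maximalRealSubfield L)))
  [MeasurableSpace ((UnitaryGroup.cmDatum L 3 H').Local v)] [BorelSpace ((UnitaryGroup.cmDatum L 3 H').Local v)]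
  [∀ γ : ((UnitaryGroup.cmDatum L 3 H').Local v), MeasurableSpace (((UnitaryGroup.cmDatum L 3 H').Local v) ⧸ (Subgroup.centralizer ({γ} : Set ((UnitaryGroup.cmDatum L 3 H').Local v))))]
  [∀ γ : ((UnitaryGroup.cmDatum L 3 H').Local v), BorelSpace (((UnitaryGroup.cmDatum L 3 H').Local v) ⧸ (Subgroup.centralizer ({γ} : Set ((UnitaryGroup.cmDatum L 3 H').Local v))))]

omit [∀ γ : ((UnitaryGroup.cmDatum L 3 H').Local v), MeasurableSpace (((UnitaryGroup.cmDatum L 3 H').Local v) ⧸ (Subgroup.centralizer ({γ} : Set ((UnitaryGroup.cmDatum L 3 H').Local v))))]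
  [∀ γ : ((UnitaryGroup.cmDatum L 3 H').Local v), BorelSpace (((UnitaryGroup.cmDatum L 3 H').Local v) ⧸ (Subgroup.centralizer ({γ} : Set ((UnitaryGroup.cmDatum L 3 H').Local v))))] in
include hherm hanis in
/-- **(P0) AT A GUARD POINT THE TAMAGAWA PARTNER `t^ω_v(x)` IS A HAAR MEASURE AND INVERSION INVARIANT** (★ `isHaarMeasure_isInvInvariant_smul_finTamagawaPartner_of_singularGuard` at `c = 1`,
J0 by ★ `lieBallVol_ne_zero_of_guard`) — the instance binders under which (P3) reads the family at `t := t^ω_v(x)`. [cite: Rogawski1990, §1.7 p. 6; §4.9 p. 54] [cite: DeitmarEchterhoff2014, Thm. 1.5.3] -/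
theorem isHaarMeasure_isInvInvariant_finTamagawaPartner_of_guard (x : ((UnitaryGroup.cmDatum L 3 H').Local v)) (hx : (∃ γ₀ : (UnitaryGroup.cmDatum L 3 H').Rational, ¬ IsRegularElt (γ₀.val : GL (Fin 3) L) ∧
        Corresponds (UnitaryGroup.conjLocal L (IsCMField.complexConj L) v) ((UnitaryGroup.adelicForm L 3 H').map (UnitaryGroup.adeleToLocal L v))
          ((UnitaryGroup.adelicForm L 3 H').map (UnitaryGroup.adeleToLocal L v)) ((UnitaryGroup.cmDatum L 3 H').toLocal v ((UnitaryGroup.cmDatum L 3 H').toAdelic γ₀)) x)) :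
    (finTamagawaPartner L 3 H' v x).IsHaarMeasure ∧ (finTamagawaPartner L 3 H' v x).IsInvInvariant := by
  have h := isHaarMeasure_isInvInvariant_smul_finTamagawaPartner_of_singularGuard L H' v hherm hanis x hx
    (lieBallVol_ne_zero_of_guard L H' hherm hanis v x hx) (one_ne_zero : (1 : ℝ≥0) ≠ 0)
  rwa [one_smul] at h

omit [∀ γ : ((UnitaryGroup.cmDatum L 3 H').Local v), MeasurableSpace (((UnitaryGroup.cmDatum L 3 H').Local v) ⧸ (Subgroup.centralizer ({γ} : Set ((UnitaryGroup.cmDatum L 3 H').Local v))))]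
  [∀ γ : ((UnitaryGroup.cmDatum L 3 H').Local v), BorelSpace (((UnitaryGroup.cmDatum L 3 H').Local v) ⧸ (Subgroup.centralizer ({γ} : Set ((UnitaryGroup.cmDatum L 3 H').Local v))))] in
include hherm hanis in
/-- **(P1) A DOCKED HAAR MEASURE IS A POSITIVE MULTIPLE OF THE TAMAGAWA PARTNER** — for any topological group `K` with a Haar measure `ν_K` and an isomorphism of topological groups
`θ : K ≃ₜ* Z(x)` onto the centraliser of a guard point `x`: `θ_* ν_K = a • t^ω_v(x)` with `0 < a` (`θ_* ν_K` Haar: Mathlib `MulEquiv.isHaarMeasure_map`; `t^ω_v(x)` Haar: (P0); Haar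
uniqueness on the second-countable locally compact `Z(x)`: Mathlib `isMulLeftInvariant_eq_smul`, `a = haarScalarFactor`, `haarScalarFactor_pos_of_isHaarMeasure`).
[cite: Rogawski1990, §1.7 p. 6; §4.9 p. 54] [cite: DeitmarEchterhoff2014, Thm. 1.5.3] -/
theorem exists_pos_map_eq_smul_finTamagawaPartner {K : Type*} [Group K] [TopologicalSpace K] [IsTopologicalGroup K] [MeasurableSpace K] [BorelSpace K]
    (νK : Measure K) [νK.IsHaarMeasure] (x : ((UnitaryGroup.cmDatum L 3 H').Local v)) (hx : (∃ γ₀ : (UnitaryGroup.cmDatum L 3 H').Rational, ¬ IsRegularElt (γ₀.val : GL (Fin 3) L) ∧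
        Corresponds (UnitaryGroup.conjLocal L (IsCMField.complexConj L) v) ((UnitaryGroup.adelicForm L 3 H').map (UnitaryGroup.adeleToLocal L v))
          ((UnitaryGroup.adelicForm L 3 H').map (UnitaryGroup.adeleToLocal L v)) ((UnitaryGroup.cmDatum L 3 H').toLocal v ((UnitaryGroup.cmDatum L 3 H').toAdelic γ₀)) x))
    (θ : K ≃ₜ* ↥(Subgroup.centralizer ({x} : Set ((UnitaryGroup.cmDatum L 3 H').Local v)))) :
    ∃ a : ℝ≥0, 0 < a ∧ Measure.map ⇑θ νK = a • finTamagawaPartner L 3 H' v x := by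
  haveI : LocallyCompactSpace ↥(Subgroup.centralizer ({x} : Set ((UnitaryGroup.cmDatum L 3 H').Local v))) :=
    (isClosed_coe_centralizer_singleton x).isClosedEmbedding_subtypeVal.locallyCompactSpace
  haveI : SecondCountableTopology ↥(Subgroup.centralizer ({x} : Set ((UnitaryGroup.cmDatum L 3 H').Local v))) := TopologicalSpace.Subtype.secondCountableTopology _
  haveI := (isHaarMeasure_isInvInvariant_finTamagawaPartner_of_guard L H' hherm hanis v x hx).1
  haveI : (Measure.map ⇑θ νK).IsHaarMeasure := MulEquiv.isHaarMeasure_map νK θ.toMulEquiv θ.continuous θ.symm.continuous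
  exact ⟨haarScalarFactor (Measure.map ⇑θ νK) (finTamagawaPartner L 3 H' v x), haarScalarFactor_pos_of_isHaarMeasure _ _, isMulLeftInvariant_eq_smul _ _⟩

omit [∀ γ : ((UnitaryGroup.cmDatum L 3 H').Local v), MeasurableSpace (((UnitaryGroup.cmDatum L 3 H').Local v) ⧸ (Subgroup.centralizer ({γ} : Set ((UnitaryGroup.cmDatum L 3 H').Local v))))]
  [∀ γ : ((UnitaryGroup.cmDatum L 3 H').Local v), BorelSpace (((UnitaryGroup.cmDatum L 3 H').Local v) ⧸ (Subgroup.centralizer ({γ} : Set ((UnitaryGroup.cmDatum L 3 H').Local v))))] in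
include hherm hanis in
/-- **(P1) AT THE CENTRAL DOCK `θ : H_v ≃ₜ* Z(x)`** (`H_v = U(Φ₂)_v × U(Φ₁)_v`, the binder shape of ★ (α) p856151 ∕ (J♮)): `θ_* ν_{H,v} = a • t^ω_v(x)`, `0 < a` — the `(aθ, haθ)` of ‹J3›.
[cite: Rogawski1990, §1.7 p. 6; §4.9 p. 54; §8.2 p. 118] [cite: DeitmarEchterhoff2014, Thm. 1.5.3] -/
theorem exists_pos_map_dock_eq_smul_finTamagawaPartner
    [MeasurableSpace (((UnitaryGroup.cmDatum L 2 (Matrix.of fun i j : Fin 2 => if i.val + j.val + 1 = 2 then (1 : L) else 0)).Local v) × ((UnitaryGroup.cmDatum L 1 (Matrix.of fun i j : Fin 1 => if i.val + j.val + 1 = 1 then (1 : L) else 0)).Local v))] [BorelSpace (((UnitaryGroup.cmDatum L 2 (Matrix.of fun i j : Fin 2 => if i.val + j.val + 1 = 2 then (1 : L) else 0)).Local v) × ((UnitaryGroup.cmDatum L 1 (Matrix.of fun i j : Fin 1 => if i.val + j.val + 1 = 1 then (1 : L) else 0)).Local v))]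
    (νHv : Measure (((UnitaryGroup.cmDatum L 2 (Matrix.of fun i j : Fin 2 => if i.val + j.val + 1 = 2 then (1 : L) else 0)).Local v) × ((UnitaryGroup.cmDatum L 1 (Matrix.of fun i j : Fin 1 => if i.val + j.val + 1 = 1 then (1 : L) else 0)).Local v))) [νHv.IsHaarMeasure] (x : ((UnitaryGroup.cmDatum L 3 H').Local v)) (hx : (∃ γ₀ : (UnitaryGroup.cmDatum L 3 H').Rational, ¬ IsRegularElt (γ₀.val : GL (Fin 3) L) ∧
        Corresponds (UnitaryGroup.conjLocal L (IsCMField.complexConj L) v) ((UnitaryGroup.adelicForm L 3 H').map (UnitaryGroup.adeleToLocal L v))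
          ((UnitaryGroup.adelicForm L 3 H').map (UnitaryGroup.adeleToLocal L v)) ((UnitaryGroup.cmDatum L 3 H').toLocal v ((UnitaryGroup.cmDatum L 3 H').toAdelic γ₀)) x))
    (θ : (((UnitaryGroup.cmDatum L 2 (Matrix.of fun i j : Fin 2 => if i.val + j.val + 1 = 2 then (1 : L) else 0)).Local v) × ((UnitaryGroup.cmDatum L 1 (Matrix.of fun i j : Fin 1 => if i.val + j.val + 1 = 1 then (1 : L) else 0)).Local v)) ≃ₜ* ↥(Subgroup.centralizer ({x} : Set ((UnitaryGroup.cmDatum L 3 H').Local v)))) :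
    ∃ a : ℝ≥0, 0 < a ∧ Measure.map ⇑θ νHv = a • finTamagawaPartner L 3 H' v x :=
  exists_pos_map_eq_smul_finTamagawaPartner L H' hherm hanis v νHv x hx θ

include hherm hanis in
/-- **(P3) THE WEIL FAMILY `dν_{G,v} ∕ dt^ω_v` READ AT A GUARD POINT AGAINST THE PARTNER ITSELF**: for `m = dν_{G,v} ∕ dt^ω_v` on the singular guard (★ `IsQuotientOf`) and a guard point `x`,
`Φ(⟦x⟧, φ; m) = Φ(x, φ; ν_{G,v} ∕ t)` for every Haar inversion-invariant `t` on `Z(x)` with `t = t^ω_v(x)` (the instance binders make the right-hand side typecheck; (P0) supplies them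
for `t^ω_v(x)`).  The guard is conjugation-stable (★ `corresponds_local_conj_right`) and the partners are coherent under conjugation on it (★ (COH-fin)₀ `map_finTamagawaPartner_conj_eq`,
its non-degeneracy input from ★ `tracePairing_nondegenerate_of_isSemisimple_of_anisotropic` ∘ ★ `forall_isSemisimple_toLin'_mat_map_eval_of_guard`), so ★
`IsQuotientOf.atPoint_eq_quotientMeasure_of_forall_map_conj_eq` reads `m` at `x` itself and ★ `orbitalIntegral_atPoint` converts to the class orbital integral.
[cite: Rogawski1990, §1.7 p. 6; §4.3 (4.3.1) p. 43] [cite: DeitmarEchterhoff2014, Thm. 1.5.3] -/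
theorem classOrbitalIntegral_mk_eq_orbitalIntegral_of_isQuotientOf_finTamagawaPartner
    (νGv : Measure ((UnitaryGroup.cmDatum L 3 H').Local v)) [νGv.IsHaarMeasure] [νGv.IsMulRightInvariant]
    {mGs₀v : OrbitalMeasureFamily ((UnitaryGroup.cmDatum L 3 H').Local v)}
    (hquot : mGs₀v.IsQuotientOf (fun x : ((UnitaryGroup.cmDatum L 3 H').Local v) => (∃ γ₀ : (UnitaryGroup.cmDatum L 3 H').Rational, ¬ IsRegularElt (γ₀.val : GL (Fin 3) L) ∧
        Corresponds (UnitaryGroup.conjLocal L (IsCMField.complexConj L) v) ((UnitaryGroup.adelicForm L 3 H').map (UnitaryGroup.adeleToLocal L v))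
          ((UnitaryGroup.adelicForm L 3 H').map (UnitaryGroup.adeleToLocal L v)) ((UnitaryGroup.cmDatum L 3 H').toLocal v ((UnitaryGroup.cmDatum L 3 H').toAdelic γ₀)) x)) νGv
      (finTamagawaPartner L 3 H' v))
    (x : ((UnitaryGroup.cmDatum L 3 H').Local v)) (hx : (∃ γ₀ : (UnitaryGroup.cmDatum L 3 H').Rational, ¬ IsRegularElt (γ₀.val : GL (Fin 3) L) ∧
        Corresponds (UnitaryGroup.conjLocal L (IsCMField.complexConj L) v) ((UnitaryGroup.adelicForm L 3 H').map (UnitaryGroup.adeleToLocal L v))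
          ((UnitaryGroup.adelicForm L 3 H').map (UnitaryGroup.adeleToLocal L v)) ((UnitaryGroup.cmDatum L 3 H').toLocal v ((UnitaryGroup.cmDatum L 3 H').toAdelic γ₀)) x)) (φ : ((UnitaryGroup.cmDatum L 3 H').Local v) → ℂ) :
    ∀ (t : Measure ↥(Subgroup.centralizer ({x} : Set ((UnitaryGroup.cmDatum L 3 H').Local v)))) [t.IsHaarMeasure] [t.IsInvInvariant], t = finTamagawaPartner L 3 H' v x →
      classOrbitalIntegral mGs₀v φ (ConjClasses.mk x) = orbitalIntegral x φ (quotientMeasure (Subgroup.centralizer ({x} : Set ((UnitaryGroup.cmDatum L 3 H').Local v))) t (isClosed_coe_centralizer_singleton x) νGv) := by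
  intro t _ _ ht
  subst ht
  -- the guard is conjugation-stable
  have hP : ∀ (γ₁ q : ((UnitaryGroup.cmDatum L 3 H').Local v)), (∃ γ₀ : (UnitaryGroup.cmDatum L 3 H').Rational, ¬ IsRegularElt (γ₀.val : GL (Fin 3) L) ∧
        Corresponds (UnitaryGroup.conjLocal L (IsCMField.complexConj L) v) ((UnitaryGroup.adelicForm L 3 H').map (UnitaryGroup.adeleToLocal L v))
          ((UnitaryGroup.adelicForm L 3 H').map (UnitaryGroup.adeleToLocal L v)) ((UnitaryGroup.cmDatum L 3 H').toLocal v ((UnitaryGroup.cmDatum L 3 H').toAdelic γ₀)) γ₁) → (∃ γ₀ : (UnitaryGroup.cmDatum L 3 H').Rational, ¬ IsRegularElt (γ₀.val : GL (Fin 3) L) ∧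
        Corresponds (UnitaryGroup.conjLocal L (IsCMField.complexConj L) v) ((UnitaryGroup.adelicForm L 3 H').map (UnitaryGroup.adeleToLocal L v))
          ((UnitaryGroup.adelicForm L 3 H').map (UnitaryGroup.adeleToLocal L v)) ((UnitaryGroup.cmDatum L 3 H').toLocal v ((UnitaryGroup.cmDatum L 3 H').toAdelic γ₀)) (q * γ₁ * q⁻¹)) :=
    fun γ₁ q ⟨γ₀, hnr, hc⟩ => ⟨γ₀, hnr, UnitaryGroup.corresponds_local_conj_right L v hc q⟩
  -- the partners are coherent under conjugation on the guard ((COH-fin)₀)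
  have hcoh : ∀ (γ₁ γ₂ q : ((UnitaryGroup.cmDatum L 3 H').Local v)) (hq : (MulAut.conj q : ((UnitaryGroup.cmDatum L 3 H').Local v) ≃* ((UnitaryGroup.cmDatum L 3 H').Local v)) γ₁ = γ₂), (∃ γ₀ : (UnitaryGroup.cmDatum L 3 H').Rational, ¬ IsRegularElt (γ₀.val : GL (Fin 3) L) ∧
        Corresponds (UnitaryGroup.conjLocal L (IsCMField.complexConj L) v) ((UnitaryGroup.adelicForm L 3 H').map (UnitaryGroup.adeleToLocal L v))
          ((UnitaryGroup.adelicForm L 3 H').map (UnitaryGroup.adeleToLocal L v)) ((UnitaryGroup.cmDatum L 3 H').toLocal v ((UnitaryGroup.cmDatum L 3 H').toAdelic γ₀)) γ₁) →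
      Measure.map (subgroupCongrHomeomorph (MulAut.conj q : ((UnitaryGroup.cmDatum L 3 H').Local v) ≃* ((UnitaryGroup.cmDatum L 3 H').Local v)) (Subgroup.centralizer ({γ₁} : Set ((UnitaryGroup.cmDatum L 3 H').Local v))) (Subgroup.centralizer ({γ₂} : Set ((UnitaryGroup.cmDatum L 3 H').Local v)))
        (forall_apply_mem_centralizer_singleton_iff_of_eq (MulAut.conj q : ((UnitaryGroup.cmDatum L 3 H').Local v) ≃* ((UnitaryGroup.cmDatum L 3 H').Local v)) hq) (continuous_mulAutConj q) (continuous_mulAutConj_symm q))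
        (finTamagawaPartner L 3 H' v γ₁) = finTamagawaPartner L 3 H' v γ₂ := by
    intro γ₁ γ₂ q hq h₁
    have h₂ : (∃ γ₀ : (UnitaryGroup.cmDatum L 3 H').Rational, ¬ IsRegularElt (γ₀.val : GL (Fin 3) L) ∧
        Corresponds (UnitaryGroup.conjLocal L (IsCMField.complexConj L) v) ((UnitaryGroup.adelicForm L 3 H').map (UnitaryGroup.adeleToLocal L v))
          ((UnitaryGroup.adelicForm L 3 H').map (UnitaryGroup.adeleToLocal L v)) ((UnitaryGroup.cmDatum L 3 H').toLocal v ((UnitaryGroup.cmDatum L 3 H').toAdelic γ₀)) γ₂) := by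
      rw [← hq, MulAut.conj_apply]
      exact hP γ₁ q h₁
    exact map_finTamagawaPartner_conj_eq L 3 H' v q γ₁ γ₂ hq
      (tracePairing_nondegenerate_of_isSemisimple_of_anisotropic L 3 H' v hherm hanis γ₂ (forall_isSemisimple_toLin'_mat_map_eval_of_guard L H' hanis v γ₂ h₂))
  obtain ⟨_, _, hq⟩ := hquot.atPoint_eq_quotientMeasure_of_forall_map_conj_eq hP hcoh x hx
  -- the class measure `m ⟦x⟧` is a Weil quotient at the representative `c x c⁻¹ = out ⟦x⟧`, hence `G′_v`-invariant (★ `IsQuotientOf.isAdmissibleOn`)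
  obtain ⟨c, hc⟩ := isConj_iff.1 (ConjClasses.mk_eq_mk_iff_isConj.1 (Quotient.out_eq (ConjClasses.mk x)).symm)
  have hPout := hP x c hx
  rw [hc] at hPout
  obtain ⟨-, hinv, -⟩ := hquot.isAdmissibleOn _ hPout
  haveI := hinv
  rw [← mGs₀v.orbitalIntegral_atPoint x φ, hq]

/-- **(P4) at `G′_v` for a smooth compactly supported `φ`**: `Z(x)` compact, `μ` Haar inversion invariant on it ⇒ `∫_{G′_v} φ(y x y⁻¹) dν_{G,v} = μ(Z(x)) · Φ(x, φ; ν_{G,v} ∕ μ)` —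
the (J♮)∕(α) currency of the compact sheet `ε′` (★ (α)'s `∫ y, φ (y * ε' * y⁻¹) ∂(νG v)`). [cite: Rogawski1990, §4.9 p. 54; §8.2 p. 118] [cite: DeitmarEchterhoff2014, Cor. 1.5.4] -/
theorem integral_conj_eq_measureReal_mul_orbitalIntegral_local (νGv : Measure ((UnitaryGroup.cmDatum L 3 H').Local v)) [νGv.IsHaarMeasure] [νGv.IsMulRightInvariant]
    (x : ((UnitaryGroup.cmDatum L 3 H').Local v)) (μ : Measure ↥(Subgroup.centralizer ({x} : Set ((UnitaryGroup.cmDatum L 3 H').Local v)))) [μ.IsHaarMeasure] [μ.IsInvInvariant]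
    [CompactSpace ↥(Subgroup.centralizer ({x} : Set ((UnitaryGroup.cmDatum L 3 H').Local v)))] (φ : ((UnitaryGroup.cmDatum L 3 H').Local v) → ℂ) (hφ : IsLocSmooth φ) :
    ∫ y, φ (y * x * y⁻¹) ∂νGv = ((μ.real Set.univ : ℝ) : ℂ) * orbitalIntegral x φ (quotientMeasure (Subgroup.centralizer ({x} : Set ((UnitaryGroup.cmDatum L 3 H').Local v))) μ (isClosed_coe_centralizer_singleton x) νGv) :=
  integral_conj_eq_measureReal_mul_orbitalIntegral νGv x μ φ hφ.continuous

end Local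

end Summit.HodgeConjecture.HodgeConjecture.Cruxes.H413.K2E3CentralizerDockHaarPlumbing

end
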